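import Literature.Analysis.Approximation.PolynomialDensityCm
import Literature.Analysis.Approximation.PolynomialCkDensity
import HarnessLib

/-!
# Density of polynomials in `𝒞_c^m(ℝⁿ)` — the proof (`Treves1967_polynomialsDense_Cm_holds`)

Topic `Literature/Analysis/Approximation`; namespace `Literature.Analysis.Approximation`.

Discharge of the named fact `Literature.Analysis.Approximation.Treves1967_polynomialsDense_Cm`
(file `PolynomialDensityCm.lean`, statement untouched): F. Trèves, *Topological Vector Spaces,
Distributions and Kernels* (1967), Ch. 15, **Corollary 2 of Lemma 15.1** (PDF p. 145) — every
`f ∈ 𝒞_c^m(ℝⁿ)` is the limit in `𝒞^m(ℝⁿ)` of a sequence of polynomials — in the `ε`–`K` form on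
`ℝⁿ = EuclideanSpace ℝ (Fin n)`.

## Proof

The analytic content is already in the tree: `PolynomialCkDensity.lean` proves Trèves' Ch. 15
chain (Lemma 15.1 regularisation, Cor. 1 Leibniz rule, Cor. 2 with a polynomial kernel, Thm. 15.3
Cor. 4 cutoff) on `ℝⁿ = Fin n → ℝ` with the sup norm, as `Treves1967_ch15_cor4_holds`. The present
file TRANSPORTS that result along the continuous linear equivalence
`L = PiLp.continuousLinearEquiv 2 ℝ _ : EuclideanSpace ℝ (Fin n) ≃L[ℝ] (Fin n → ℝ)` (the identity
on coordinates): with `g = f ∘ L⁻¹` (again `𝒞^m` with compact support) and the compact set `L '' K`,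
the polynomial `P` given by Cor. 4 on `Ω = ℝⁿ` satisfies, for `x ∈ K` and `i ≤ m`,
`Dⁱ(f − P)(x) = −(Dⁱ(P − g)(L x)) ∘ (L, …, L)` (`ContinuousLinearEquiv.iteratedFDerivWithin_comp_right`),
whence `‖Dⁱ(f − P)(x)‖ ≤ ‖Dⁱ(P − g)(L x)‖ · ‖L‖ⁱ ≤ ε`, because the operator norm of `L` is at
most `1` (`‖y‖_∞ ≤ ‖y‖₂`). No new definitions, no new named facts.

## References

* [Treves1967] F. Trèves, *Topological Vector Spaces, Distributions and Kernels*, Academic Press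
  1967, Ch. 15, Lemma 15.1 and Corollaries 1–2 (PDF pp. 144–145). Held:
  `book:treves1967-topological-vector-spaces-distributions-kernels`.
-/

open scoped ContDiff
open Set

noncomputable section

namespace Literature.Analysis.Approximation

variable {n : ℕ}

/-- The coordinate map `EuclideanSpace ℝ (Fin n) → (Fin n → ℝ)` (identity on coordinates,
Euclidean norm to sup norm) has operator norm at most `1`: `|y j| ≤ ‖y‖₂`. [folklore] -/
private lemma norm_piLpContinuousLinearEquiv_le_one :
    ‖((PiLp.continuousLinearEquiv 2 ℝ (fun _ : Fin n => ℝ) :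
        EuclideanSpace ℝ (Fin n) ≃L[ℝ] (Fin n → ℝ)) : EuclideanSpace ℝ (Fin n) →L[ℝ] (Fin n → ℝ))‖
      ≤ 1 := by
  refine ContinuousLinearMap.opNorm_le_bound _ zero_le_one fun y => ?_
  rw [one_mul, pi_norm_le_iff_of_nonneg (norm_nonneg y)]
  intro j
  have h : ‖y j‖ ^ 2 ≤ ‖y‖ ^ 2 := by
    rw [EuclideanSpace.norm_eq, Real.sq_sqrt (Finset.sum_nonneg fun k _ => sq_nonneg _)]
    exact Finset.single_le_sum (f := fun k => ‖y k‖ ^ 2) (fun k _ => sq_nonneg _)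
      (Finset.mem_univ j)
  have h' : ‖y j‖ ≤ ‖y‖ :=
    (pow_le_pow_iff_left₀ (norm_nonneg _) (norm_nonneg _) two_ne_zero).1 h
  simpa using h'

/-- **Trèves 1967, Ch. 15, Corollary 2 of Lemma 15.1, discharged** (polynomials are dense in
`𝒞_c^m(ℝⁿ)` for the `𝒞^m` topology, `ε`–`K` form on `EuclideanSpace ℝ (Fin n)`): transport of
`Treves1967_ch15_cor4_holds` (the sup-norm model `Fin n → ℝ`, `Ω = ℝⁿ`) along the coordinate
equivalence `EuclideanSpace ℝ (Fin n) ≃L[ℝ] (Fin n → ℝ)`, whose operator norm is `≤ 1`, using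
`Dⁱ(h ∘ L)(x) = Dⁱh(Lx) ∘ (L,…,L)`. [cite: Treves1967, Ch. 15, Cor. 2 of Lemma 15.1, p. 145] -/
theorem Treves1967_polynomialsDense_Cm_holds : Treves1967_polynomialsDense_Cm := by
  intro n m f hf hfc K hK ε hε
  set L : EuclideanSpace ℝ (Fin n) ≃L[ℝ] (Fin n → ℝ) :=
    PiLp.continuousLinearEquiv 2 ℝ (fun _ : Fin n => ℝ) with hL
  have hg : ContDiff ℝ m (f ∘ L.symm) := hf.comp L.symm.contDiff
  have hgc : HasCompactSupport (f ∘ L.symm) := hfc.comp_homeomorph L.symm.toHomeomorph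
  have hK' : IsCompact (L '' K) := hK.image L.continuous
  obtain ⟨P, hP⟩ := Treves1967_ch15_cor4_holds n m univ isOpen_univ (f ∘ L.symm) hg.contDiffOn
    (L '' K) hK' (subset_univ _) ε hε
  refine ⟨P, fun i hi x hx => ?_⟩
  have hfun : (fun y : EuclideanSpace ℝ (Fin n) => f y - MvPolynomial.eval (fun j => y j) P) =
      -((fun z : Fin n → ℝ => MvPolynomial.eval z P - (f ∘ L.symm) z) ∘ L) := by
    funext y
    simp only [Pi.neg_apply, Function.comp_apply, ContinuousLinearEquiv.symm_apply_apply,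
      neg_sub]
    rfl
  have hcomp : iteratedFDeriv ℝ i
      ((fun z : Fin n → ℝ => MvPolynomial.eval z P - (f ∘ L.symm) z) ∘ L) x =
      (iteratedFDeriv ℝ i (fun z : Fin n → ℝ => MvPolynomial.eval z P - (f ∘ L.symm) z)
        (L x)).compContinuousLinearMap
        fun _ => (L : EuclideanSpace ℝ (Fin n) →L[ℝ] (Fin n → ℝ)) := by
    have h := L.iteratedFDerivWithin_comp_right
      (fun z : Fin n → ℝ => MvPolynomial.eval z P - (f ∘ L.symm) z) uniqueDiffOn_univ
      (mem_univ (L x)) i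
    simp only [preimage_univ, iteratedFDerivWithin_univ] at h
    exact h
  rw [hfun, iteratedFDeriv_neg_apply, norm_neg, hcomp]
  calc ‖(iteratedFDeriv ℝ i (fun z : Fin n → ℝ => MvPolynomial.eval z P - (f ∘ L.symm) z)
            (L x)).compContinuousLinearMap fun _ => (L : EuclideanSpace ℝ (Fin n) →L[ℝ] (Fin n → ℝ))‖
        ≤ ‖iteratedFDeriv ℝ i (fun z : Fin n → ℝ => MvPolynomial.eval z P - (f ∘ L.symm) z) (L x)‖ *
            ∏ _ : Fin i, ‖(L : EuclideanSpace ℝ (Fin n) →L[ℝ] (Fin n → ℝ))‖ :=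
          ContinuousMultilinearMap.norm_compContinuousLinearMap_le _ _
    _ ≤ ε * 1 := by
          refine mul_le_mul (hP i hi (L x) (mem_image_of_mem _ hx)) ?_
            (Finset.prod_nonneg fun _ _ => norm_nonneg _) hε.le
          exact Finset.prod_le_one (fun _ _ => norm_nonneg _)
            fun _ _ => by rw [hL]; exact norm_piLpContinuousLinearEquiv_le_one
    _ = ε := mul_one ε

end Literature.Analysis.Approximation

end
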